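import Summits.QuantumFields.BalabanUV.T4Continuum.Spine.BackgroundResolventTower
import Literature.MathematicalPhysics.QuantumLattice.TransferOperatorDual

/-!
# T⁴ programme, spine node NE2 (U1a), tier B row B4.b — RESOLVENT BOUNDS for the factorised `DRD*` summand: positivity makes
# `Z = Q′(U)·G′(U)·D_U*` bounded, the `U`- and `1`-resolvents differ by the size of the background WITHOUT Leibniz, and the
# two-level data of `SandwichLaws` reduce to scalar-tower numbers

ROUND-2 swarm `t4-ne2-formalise-*`, leaf prover 05, row **B4.b**, file 2a (file 1: `Support/GaugeTermSandwichLaw`, the abstract law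
`perturbationLaws_sandwich_sub` for a difference of two sandwich families `Zᴴ N Z`).  Bałaban's gauge term ([Balaban1985BackgroundPropagators]
(3.26) p. 395 «Δ_a = Δ + DRD* + Q*aQ») with `P(U) := 1 − R(U) = G′Q′*(Q′G′²Q′*)⁻¹Q′G′` ((3.25) p. 394), `G′ = (Δ′_a)⁻¹`, «Δ′_a = Δ_U + Q′*aQ′»
((3.24)) gives `D_U P(U) D_U* = Zᴴ N Z`, `Z = Q′(U)·G′(U)·D_U*`, `N = (Q′G′²Q′*)⁻¹`.  The scalar operator has the GRAM-PLUS-POSITIVE shape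
`S = XᴴX + Y` (`X = D_U`, `Y = Q′*aQ′ ⪰ 0`); that shape alone — no Fourier analysis, no commutator, no Leibniz rule — gives, at ONE level:
 * §1 POSITIVITY (any `S = XᴴX + Y`, `Y ⪰ 0`, `S` invertible): **`opNorm_mul_inv_le_sqrt`** `‖X·S⁻¹‖ ≤ √‖S⁻¹‖`,
   **`opNorm_inv_mul_conjTranspose_le_sqrt`**, **`opNorm_mul_inv_mul_conjTranspose_le_one`** `‖X·S⁻¹·Xᴴ‖ ≤ 1` (Rayleigh quotients,
   `QuantumLattice.l2_opNorm_le_of_abs_re_le`) — the covariant derivative of the covariant scalar propagator is bounded by `‖G′(U)‖^{1/2}`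
   at EVERY background;
 * §2 `D_U = ∂ + W` (`‖W‖ ≤ α`), `S_U = D_UᴴD_U + Y_U`, `S_1 = ∂ᴴ∂ + Y_1`, `‖Y_U − Y_1‖ ≤ y`, `‖S_U⁻¹‖ ≤ g_U`, `‖S_1⁻¹‖ ≤ g_1`: the exact
   splitting `S_U − S_1 = D_UᴴW + Wᴴ∂ + (Y_U − Y_1)` (`gram_sub_gram`), **`opNorm_inv_sub_inv_le_gram`** `‖S_U⁻¹ − S_1⁻¹‖ ≤ √g_U·α·g_1 +
   g_U·α·√g_1 + g_U·y·g_1`, **`opNorm_inv_mul_DH_sub_le`** `‖S_U⁻¹D_Uᴴ − S_1⁻¹∂ᴴ‖ ≤ 2g_Uα + √g_U·α·√g_1 + g_U·y·√g_1`;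
 * the companion `Support/GaugeTermTwoLevelNumbers` turns these into the fields of `SandwichLaws` (sizes, differences, the unit-layer
   factor `N = (Q′G′²Q′*)⁻¹` by Neumann around the `U = 1` datum `n₁` of row B4.c, and the two-level numbers `ζ`, `ν` from the scalar
   tower's injected/complement numbers — rows B4.d/B4.e — and the covariant-divergence planting number `θ` — row B4.f); file 3
   (`GaugeTermPerturbationLaw`) is the instance on row B4.a's typed objects.

HONEST FRAMING (T4-DAG p. 1).  [folklore]-level finite-dimensional linear algebra in the `ℓ²`-operator norm, statements OURS; model level
(transporters / covariant averagings / the scalar resolvent are typed data when instantiated; no assertion of the dictionary B0, trigger c5);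
GLOBAL small field, finite torus, linear layer; NOT [B9] (3.23)–(3.26) as printed (no Dirichlet regions, no multi-scale kernels); NE2 NOT
proved; NOT infinite volume, NOT a mass gap, NOT Clay, NOT summit progress; spine 0/9 unchanged.  HONEST DEPENDENCY: continuum YM on T⁴ ⇐
BetaPertH ∧ nine spine estimates (0/9 proved); BetaPertH ⇐ (D1) ∧ (D4) ∧ CAP+tail; G-an2-4 gates asym, D1 and NE2/3/4.  ABSOLUTE RULE kept:
nothing printed is a hypothesis; no `sorry`.
-/

noncomputable section

open scoped BigOperators ComplexConjugate Matrix Matrix.Norms.L2Operator ComplexOrder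

namespace Summit.QuantumFields.BalabanUV.T4Continuum.GaugeTermResolventBounds

open Literature.MathematicalPhysics.QuantumFieldTheory.Balaban1983to89.B5Prop11Lower (nsq nsq_nonneg nsq_mulVec_le
  sqrt_nsq_mulVec_le star_dotProduct_self norm_star_dotProduct_le)
open Literature.MathematicalPhysics.QuantumLattice (l2_opNorm_le_of_abs_re_le)
open Summit.QuantumFields.BalabanUV.T4Continuum
open Summit.QuantumFields.BalabanUV.T4Continuum.BackgroundResolventLaw

/-! ## §1 Positivity: `S = XᴴX + Y`, `Y ⪰ 0` -/

section Positivity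

variable {σ τ : Type*} [Fintype σ] [DecidableEq σ] [Fintype τ] [DecidableEq τ]

omit [DecidableEq σ] [DecidableEq τ] in
/-- `‖Xw‖ ≤ ‖X‖‖w‖` for a rectangular matrix (via the square Gram matrix `XᴴX`). [folklore] -/
theorem re_form_gram (X : Matrix τ σ ℂ) (w : σ → ℂ) : (star w ⬝ᵥ ((Xᴴ * X) *ᵥ w)).re = nsq (X *ᵥ w) := by
  rw [← Matrix.mulVec_mulVec, Matrix.dotProduct_mulVec, Matrix.vecMul_conjTranspose, star_star, star_dotProduct_self,
    Complex.ofReal_re]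

omit [Fintype σ] [DecidableEq σ] [DecidableEq τ] in
/-- the Gram-plus-positive operator is Hermitian. [folklore] -/
theorem conjTranspose_gram_add {S Y : Matrix σ σ ℂ} {X : Matrix τ σ ℂ} (hS : S = Xᴴ * X + Y) (hY : Y.PosSemidef) : Sᴴ = S := by
  rw [hS, Matrix.conjTranspose_add, Matrix.conjTranspose_mul, Matrix.conjTranspose_conjTranspose, hY.isHermitian.eq]

omit [DecidableEq σ] [DecidableEq τ] in
/-- `Re⟨w, Sw⟩ ≥ ‖Xw‖²` for `S = XᴴX + Y`, `Y ⪰ 0`. [folklore] -/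
theorem nsq_le_re_form {S Y : Matrix σ σ ℂ} {X : Matrix τ σ ℂ} (hS : S = Xᴴ * X + Y) (hY : Y.PosSemidef) (w : σ → ℂ) :
    nsq (X *ᵥ w) ≤ (star w ⬝ᵥ (S *ᵥ w)).re := by
  have hYw : 0 ≤ (star w ⬝ᵥ (Y *ᵥ w)).re := by simpa using hY.re_dotProduct_nonneg w
  rw [hS, Matrix.add_mulVec, dotProduct_add, Complex.add_re, re_form_gram]
  linarith

omit [DecidableEq τ] in
/-- the quadratic form of the inverse at `x` is `Re⟨S⁻¹x, x⟩ ≤ ‖S⁻¹‖·‖x‖²` and dominates `‖X S⁻¹ x‖²`. [folklore] -/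
theorem nsq_mul_inv_mulVec_le {S Y : Matrix σ σ ℂ} {X : Matrix τ σ ℂ} (hS : S = Xᴴ * X + Y) (hY : Y.PosSemidef)
    (hSU : IsUnit S.det) (x : σ → ℂ) : nsq (X *ᵥ (S⁻¹ *ᵥ x)) ≤ ‖S⁻¹‖ * nsq x := by
  set w := S⁻¹ *ᵥ x with hw
  have hSw : S *ᵥ w = x := by rw [hw, Matrix.mulVec_mulVec, Matrix.mul_nonsing_inv S hSU, Matrix.one_mulVec]
  have h1 : nsq (X *ᵥ w) ≤ (star w ⬝ᵥ x).re := by simpa only [hSw] using nsq_le_re_form hS hY w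
  have h2 : (star w ⬝ᵥ x).re ≤ Real.sqrt (nsq w) * Real.sqrt (nsq x) :=
    (Complex.re_le_norm _).trans (norm_star_dotProduct_le w x)
  have h3 : Real.sqrt (nsq w) ≤ ‖S⁻¹‖ * Real.sqrt (nsq x) := sqrt_nsq_mulVec_le S⁻¹ x
  have hx : 0 ≤ Real.sqrt (nsq x) := Real.sqrt_nonneg _
  calc nsq (X *ᵥ w) ≤ Real.sqrt (nsq w) * Real.sqrt (nsq x) := h1.trans h2
    _ ≤ ‖S⁻¹‖ * Real.sqrt (nsq x) * Real.sqrt (nsq x) := mul_le_mul_of_nonneg_right h3 hx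
    _ = ‖S⁻¹‖ * nsq x := by rw [mul_assoc, Real.mul_self_sqrt (nsq_nonneg x)]

omit [DecidableEq τ] in
/-- **`‖X·S⁻¹‖ ≤ √‖S⁻¹‖`** for `S = XᴴX + Y`, `Y ⪰ 0`, `S` invertible (`‖XS⁻¹‖² = ‖S⁻¹XᴴXS⁻¹‖`, a Hermitian matrix whose
Rayleigh quotients are `‖XS⁻¹x‖²/‖x‖² ≤ ‖S⁻¹‖`). [folklore] -/
theorem opNorm_mul_inv_le_sqrt {S Y : Matrix σ σ ℂ} {X : Matrix τ σ ℂ} (hS : S = Xᴴ * X + Y) (hY : Y.PosSemidef)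
    (hSU : IsUnit S.det) : ‖X * S⁻¹‖ ≤ Real.sqrt ‖S⁻¹‖ := by
  have hSH := conjTranspose_gram_add hS hY
  have hSiH : (S⁻¹)ᴴ = S⁻¹ := by rw [Matrix.conjTranspose_nonsing_inv, hSH]
  have hM : (X * S⁻¹)ᴴ * (X * S⁻¹) = S⁻¹ * (Xᴴ * X) * S⁻¹ := by
    rw [Matrix.conjTranspose_mul, hSiH, Matrix.mul_assoc, Matrix.mul_assoc, Matrix.mul_assoc]
  have hMH : (S⁻¹ * (Xᴴ * X) * S⁻¹).IsHermitian := by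
    rw [← hM]; exact Matrix.isHermitian_conjTranspose_mul_self _
  have hbound : ‖S⁻¹ * (Xᴴ * X) * S⁻¹‖ ≤ ‖S⁻¹‖ := by
    refine l2_opNorm_le_of_abs_re_le hMH (norm_nonneg _) fun x => ?_
    have hv : star x ᵥ* S⁻¹ = star (S⁻¹ *ᵥ x) := by rw [Matrix.star_mulVec, hSiH]
    have e : star x ⬝ᵥ ((S⁻¹ * (Xᴴ * X) * S⁻¹) *ᵥ x) = star (S⁻¹ *ᵥ x) ⬝ᵥ ((Xᴴ * X) *ᵥ (S⁻¹ *ᵥ x)) := by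
      rw [← Matrix.mulVec_mulVec, ← Matrix.mulVec_mulVec, Matrix.dotProduct_mulVec, hv]
    rw [e, re_form_gram, abs_of_nonneg (nsq_nonneg _), star_dotProduct_self, Complex.ofReal_re]
    exact nsq_mul_inv_mulVec_le hS hY hSU x
  have hsq : ‖X * S⁻¹‖ * ‖X * S⁻¹‖ ≤ ‖S⁻¹‖ := by
    rw [← Matrix.l2_opNorm_conjTranspose_mul_self, hM]; exact hbound
  calc ‖X * S⁻¹‖ = Real.sqrt (‖X * S⁻¹‖ * ‖X * S⁻¹‖) := (Real.sqrt_mul_self (norm_nonneg _)).symm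
    _ ≤ Real.sqrt ‖S⁻¹‖ := Real.sqrt_le_sqrt hsq

/-- **`‖S⁻¹·Xᴴ‖ ≤ √‖S⁻¹‖`** (adjoint of the previous one; `S⁻¹` is Hermitian). [folklore] -/
theorem opNorm_inv_mul_conjTranspose_le_sqrt {S Y : Matrix σ σ ℂ} {X : Matrix τ σ ℂ} (hS : S = Xᴴ * X + Y) (hY : Y.PosSemidef)
    (hSU : IsUnit S.det) : ‖S⁻¹ * Xᴴ‖ ≤ Real.sqrt ‖S⁻¹‖ := by
  have hSH := conjTranspose_gram_add hS hY
  have hSiH : (S⁻¹)ᴴ = S⁻¹ := by rw [Matrix.conjTranspose_nonsing_inv, hSH]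
  have e : S⁻¹ * Xᴴ = (X * S⁻¹)ᴴ := by rw [Matrix.conjTranspose_mul, hSiH]
  rw [e, Matrix.l2_opNorm_conjTranspose]; exact opNorm_mul_inv_le_sqrt hS hY hSU

/-- **`‖X·S⁻¹·Xᴴ‖ ≤ 1`** for `S = XᴴX + Y`, `Y ⪰ 0`, `S` invertible. [folklore] -/
theorem opNorm_mul_inv_mul_conjTranspose_le_one {S Y : Matrix σ σ ℂ} {X : Matrix τ σ ℂ} (hS : S = Xᴴ * X + Y) (hY : Y.PosSemidef)
    (hSU : IsUnit S.det) : ‖X * S⁻¹ * Xᴴ‖ ≤ 1 := by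
  have hSH := conjTranspose_gram_add hS hY
  have hSiH : (S⁻¹)ᴴ = S⁻¹ := by rw [Matrix.conjTranspose_nonsing_inv, hSH]
  have hMH : (X * S⁻¹ * Xᴴ).IsHermitian := by
    change (X * S⁻¹ * Xᴴ)ᴴ = X * S⁻¹ * Xᴴ
    rw [Matrix.conjTranspose_mul, Matrix.conjTranspose_mul, Matrix.conjTranspose_conjTranspose, hSiH, Matrix.mul_assoc]
  refine l2_opNorm_le_of_abs_re_le hMH zero_le_one fun v => ?_
  -- `u = Xᴴv`, `w = S⁻¹u`: the form is `⟨v, Xw⟩ = ⟨u, w⟩ = ⟨Sw, w⟩`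
  set u := Xᴴ *ᵥ v with hu
  set w := S⁻¹ *ᵥ u with hw
  have hSw : S *ᵥ w = u := by rw [hw, Matrix.mulVec_mulVec, Matrix.mul_nonsing_inv S hSU, Matrix.one_mulVec]
  have e1 : star v ⬝ᵥ ((X * S⁻¹ * Xᴴ) *ᵥ v) = star v ⬝ᵥ (X *ᵥ w) := by
    rw [hw, hu, Matrix.mulVec_mulVec, Matrix.mulVec_mulVec]
  have e2 : star v ⬝ᵥ (X *ᵥ w) = star u ⬝ᵥ w := by
    rw [Matrix.dotProduct_mulVec, hu, ← Matrix.conjTranspose_conjTranspose X, Matrix.vecMul_conjTranspose,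
      Matrix.conjTranspose_conjTranspose, star_star]
  have e3 : star u ⬝ᵥ w = star w ⬝ᵥ (S *ᵥ w) := by
    rw [← hSw, Matrix.star_mulVec, hSH, ← Matrix.dotProduct_mulVec]
  -- lower bound `0 ≤ ‖Xw‖² ≤ Re(form)` and upper bound `Re(form) ≤ ‖v‖·‖Xw‖`
  have hlow : nsq (X *ᵥ w) ≤ (star v ⬝ᵥ (X *ᵥ w)).re := by rw [e2, e3]; exact nsq_le_re_form hS hY w
  have hup : (star v ⬝ᵥ (X *ᵥ w)).re ≤ Real.sqrt (nsq v) * Real.sqrt (nsq (X *ᵥ w)) :=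
    (Complex.re_le_norm _).trans (norm_star_dotProduct_le v _)
  have hv : 0 ≤ Real.sqrt (nsq v) := Real.sqrt_nonneg _
  have hXw : 0 ≤ Real.sqrt (nsq (X *ᵥ w)) := Real.sqrt_nonneg _
  -- hence `√nsq(Xw) ≤ √nsq(v)`
  have hroot : Real.sqrt (nsq (X *ᵥ w)) ≤ Real.sqrt (nsq v) := by
    have h1 : Real.sqrt (nsq (X *ᵥ w)) * Real.sqrt (nsq (X *ᵥ w)) ≤ Real.sqrt (nsq v) * Real.sqrt (nsq (X *ᵥ w)) := by
      rw [Real.mul_self_sqrt (nsq_nonneg _)]; exact hlow.trans hup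
    rcases eq_or_lt_of_le hXw with h0 | hpos
    · rw [← h0]; exact hv
    · exact le_of_mul_le_mul_right h1 hpos
  rw [e1, abs_of_nonneg ((nsq_nonneg _).trans hlow), star_dotProduct_self, Complex.ofReal_re, one_mul]
  calc (star v ⬝ᵥ (X *ᵥ w)).re ≤ Real.sqrt (nsq v) * Real.sqrt (nsq (X *ᵥ w)) := hup
    _ ≤ Real.sqrt (nsq v) * Real.sqrt (nsq v) := mul_le_mul_of_nonneg_left hroot hv
    _ = nsq v := Real.mul_self_sqrt (nsq_nonneg v)

end Positivity

/-! ## §2 The `U`-resolvent against the `1`-resolvent, without Leibniz -/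

section Resolvents

variable {σ τ : Type*} [Fintype σ] [DecidableEq σ] [Fintype τ] [DecidableEq τ]

omit [Fintype σ] [DecidableEq σ] [DecidableEq τ] in
/-- **the exact splitting** `S_U − S_1 = D_UᴴW + Wᴴ∂ + (Y_U − Y_1)` for `S_U = D_UᴴD_U + Y_U`, `S_1 = ∂ᴴ∂ + Y_1`, `D_U = ∂ + W`.
[folklore] -/
theorem gram_sub_gram (Dt W : Matrix τ σ ℂ) (Y₁ Yu : Matrix σ σ ℂ) :
    ((Dt + W)ᴴ * (Dt + W) + Yu) - (Dtᴴ * Dt + Y₁) = (Dt + W)ᴴ * W + Wᴴ * Dt + (Yu - Y₁) := by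
  simp only [Matrix.conjTranspose_add, Matrix.add_mul, Matrix.mul_add]
  abel

/-- the resolvent identity `A⁻¹ − B⁻¹ = A⁻¹(B − A)B⁻¹`. [folklore] -/
theorem inv_sub_inv_eq' {A B : Matrix σ σ ℂ} (hA : IsUnit A.det) (hB : IsUnit B.det) : A⁻¹ - B⁻¹ = A⁻¹ * (B - A) * B⁻¹ := by
  rw [Matrix.mul_sub, Matrix.sub_mul, Matrix.mul_assoc, Matrix.mul_nonsing_inv B hB, Matrix.mul_one, Matrix.nonsing_inv_mul A hA,
    Matrix.one_mul]

omit [Fintype σ] [DecidableEq σ] [Fintype τ] [DecidableEq τ] in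
/-- `√‖S⁻¹‖ ≤ √g` from `‖S⁻¹‖ ≤ g`. [folklore] -/
theorem sqrt_opNorm_le {E : Type*} [SeminormedAddCommGroup E] {A : E} {g : ℝ} (h : ‖A‖ ≤ g) : Real.sqrt ‖A‖ ≤ Real.sqrt g :=
  Real.sqrt_le_sqrt h

/-- **`‖S_U⁻¹ − S_1⁻¹‖ ≤ √g_U·α·g_1 + g_U·α·√g_1 + g_U·y·g_1`** — the two scalar resolvents differ by the size of the background;
every unbounded factor (`D_Uᴴ` on the left of `W`, `∂` on the right of `Wᴴ`) is absorbed by a resolvent through §1. [folklore] -/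
theorem opNorm_inv_sub_inv_le_gram {Dt W : Matrix τ σ ℂ} {Y₁ Yu S₁ Su : Matrix σ σ ℂ} (hS₁ : S₁ = Dtᴴ * Dt + Y₁)
    (hSu : Su = (Dt + W)ᴴ * (Dt + W) + Yu) (hY₁ : Y₁.PosSemidef) (hYu : Yu.PosSemidef) (h₁ : IsUnit S₁.det) (hu : IsUnit Su.det)
    {g₁ gu α y : ℝ} (hg₁ : ‖S₁⁻¹‖ ≤ g₁) (hgu : ‖Su⁻¹‖ ≤ gu) (hW : ‖W‖ ≤ α) (hy : ‖Yu - Y₁‖ ≤ y) :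
    ‖Su⁻¹ - S₁⁻¹‖ ≤ Real.sqrt gu * α * g₁ + gu * α * Real.sqrt g₁ + gu * y * g₁ := by
  have hα : 0 ≤ α := (norm_nonneg _).trans hW
  have hgu0 : 0 ≤ gu := (norm_nonneg _).trans hgu
  have hsgu : 0 ≤ Real.sqrt gu := Real.sqrt_nonneg _
  have e : Su⁻¹ - S₁⁻¹ = -(Su⁻¹ * (Dt + W)ᴴ * W * S₁⁻¹ + Su⁻¹ * Wᴴ * (Dt * S₁⁻¹) + Su⁻¹ * (Yu - Y₁) * S₁⁻¹) := by
    rw [inv_sub_inv_eq' hu h₁, ← neg_sub Su S₁, hSu, hS₁, gram_sub_gram, ← hSu, ← hS₁]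
    simp only [Matrix.mul_neg, Matrix.neg_mul, Matrix.mul_add, Matrix.add_mul, Matrix.mul_assoc]
  rw [e, norm_neg]
  have t1 : ‖Su⁻¹ * (Dt + W)ᴴ * W * S₁⁻¹‖ ≤ Real.sqrt gu * α * g₁ :=
    (Matrix.l2_opNorm_mul _ _).trans (mul_le_mul ((Matrix.l2_opNorm_mul _ _).trans (mul_le_mul
      ((opNorm_inv_mul_conjTranspose_le_sqrt hSu hYu hu).trans (sqrt_opNorm_le hgu)) hW (norm_nonneg _) hsgu)) hg₁ (norm_nonneg _)
      (mul_nonneg hsgu hα))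
  have t2 : ‖Su⁻¹ * Wᴴ * (Dt * S₁⁻¹)‖ ≤ gu * α * Real.sqrt g₁ := by
    refine (Matrix.l2_opNorm_mul _ _).trans (mul_le_mul ((Matrix.l2_opNorm_mul _ _).trans (mul_le_mul hgu ?_ (norm_nonneg _) hgu0))
      ((opNorm_mul_inv_le_sqrt hS₁ hY₁ h₁).trans (sqrt_opNorm_le hg₁)) (norm_nonneg _) (mul_nonneg hgu0 hα))
    rw [Matrix.l2_opNorm_conjTranspose]; exact hW
  have t3 : ‖Su⁻¹ * (Yu - Y₁) * S₁⁻¹‖ ≤ gu * y * g₁ :=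
    (Matrix.l2_opNorm_mul _ _).trans (mul_le_mul ((Matrix.l2_opNorm_mul _ _).trans (mul_le_mul hgu hy (norm_nonneg _) hgu0)) hg₁
      (norm_nonneg _) (mul_nonneg hgu0 ((norm_nonneg _).trans hy)))
  calc _ ≤ ‖Su⁻¹ * (Dt + W)ᴴ * W * S₁⁻¹ + Su⁻¹ * Wᴴ * (Dt * S₁⁻¹)‖ + ‖Su⁻¹ * (Yu - Y₁) * S₁⁻¹‖ := norm_add_le _ _
    _ ≤ (‖Su⁻¹ * (Dt + W)ᴴ * W * S₁⁻¹‖ + ‖Su⁻¹ * Wᴴ * (Dt * S₁⁻¹)‖) + ‖Su⁻¹ * (Yu - Y₁) * S₁⁻¹‖ :=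
        add_le_add (norm_add_le _ _) le_rfl
    _ ≤ _ := add_le_add (add_le_add t1 t2) t3

/-- **`‖S_U⁻¹D_Uᴴ − S_1⁻¹∂ᴴ‖ ≤ 2g_Uα + √g_U·α·√g_1 + g_U·y·√g_1`** — the outer factor of `Z` moves by the size of the background
(`S_U⁻¹D_Uᴴ − S_1⁻¹∂ᴴ = S_U⁻¹Wᴴ − [S_U⁻¹D_UᴴW·S_1⁻¹∂ᴴ + S_U⁻¹Wᴴ·∂S_1⁻¹∂ᴴ + S_U⁻¹(Y_U − Y_1)·S_1⁻¹∂ᴴ]`, `‖∂S_1⁻¹∂ᴴ‖ ≤ 1`).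
[folklore] -/
theorem opNorm_inv_mul_DH_sub_le {Dt W : Matrix τ σ ℂ} {Y₁ Yu S₁ Su : Matrix σ σ ℂ} (hS₁ : S₁ = Dtᴴ * Dt + Y₁)
    (hSu : Su = (Dt + W)ᴴ * (Dt + W) + Yu) (hY₁ : Y₁.PosSemidef) (hYu : Yu.PosSemidef) (h₁ : IsUnit S₁.det) (hu : IsUnit Su.det)
    {g₁ gu α y : ℝ} (hg₁ : ‖S₁⁻¹‖ ≤ g₁) (hgu : ‖Su⁻¹‖ ≤ gu) (hW : ‖W‖ ≤ α) (hy : ‖Yu - Y₁‖ ≤ y) :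
    ‖Su⁻¹ * (Dt + W)ᴴ - S₁⁻¹ * Dtᴴ‖ ≤ 2 * gu * α + Real.sqrt gu * α * Real.sqrt g₁ + gu * y * Real.sqrt g₁ := by
  have hα : 0 ≤ α := (norm_nonneg _).trans hW
  have hgu0 : 0 ≤ gu := (norm_nonneg _).trans hgu
  have hsgu : 0 ≤ Real.sqrt gu := Real.sqrt_nonneg _
  have hsg₁ : 0 ≤ Real.sqrt g₁ := Real.sqrt_nonneg _
  have hWH : ‖Wᴴ‖ ≤ α := by rw [Matrix.l2_opNorm_conjTranspose]; exact hW
  have hB : ‖S₁⁻¹ * Dtᴴ‖ ≤ Real.sqrt g₁ := (opNorm_inv_mul_conjTranspose_le_sqrt hS₁ hY₁ h₁).trans (sqrt_opNorm_le hg₁)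
  have hA : ‖Su⁻¹ * (Dt + W)ᴴ‖ ≤ Real.sqrt gu := (opNorm_inv_mul_conjTranspose_le_sqrt hSu hYu hu).trans (sqrt_opNorm_le hgu)
  have hP : ‖Dt * S₁⁻¹ * Dtᴴ‖ ≤ 1 := opNorm_mul_inv_mul_conjTranspose_le_one hS₁ hY₁ h₁
  have e : Su⁻¹ * (Dt + W)ᴴ - S₁⁻¹ * Dtᴴ
      = Su⁻¹ * Wᴴ - (Su⁻¹ * (Dt + W)ᴴ * W * (S₁⁻¹ * Dtᴴ) + Su⁻¹ * Wᴴ * (Dt * S₁⁻¹ * Dtᴴ)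
          + Su⁻¹ * (Yu - Y₁) * (S₁⁻¹ * Dtᴴ)) := by
    have h0 : Su⁻¹ * (Dt + W)ᴴ - S₁⁻¹ * Dtᴴ = Su⁻¹ * Wᴴ + (Su⁻¹ - S₁⁻¹) * Dtᴴ := by
      rw [Matrix.conjTranspose_add, Matrix.mul_add, Matrix.sub_mul]; abel
    rw [h0, inv_sub_inv_eq' hu h₁, ← neg_sub Su S₁, hSu, hS₁, gram_sub_gram, ← hSu, ← hS₁]
    simp only [Matrix.mul_neg, Matrix.neg_mul, Matrix.mul_add, Matrix.add_mul, Matrix.mul_assoc]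
    abel
  rw [e]
  have t0 : ‖Su⁻¹ * Wᴴ‖ ≤ gu * α := (Matrix.l2_opNorm_mul _ _).trans (mul_le_mul hgu hWH (norm_nonneg _) hgu0)
  have t1 : ‖Su⁻¹ * (Dt + W)ᴴ * W * (S₁⁻¹ * Dtᴴ)‖ ≤ Real.sqrt gu * α * Real.sqrt g₁ :=
    (Matrix.l2_opNorm_mul _ _).trans (mul_le_mul ((Matrix.l2_opNorm_mul _ _).trans (mul_le_mul hA hW (norm_nonneg _) hsgu)) hB
      (norm_nonneg _) (mul_nonneg hsgu hα))
  have t2 : ‖Su⁻¹ * Wᴴ * (Dt * S₁⁻¹ * Dtᴴ)‖ ≤ gu * α * 1 :=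
    (Matrix.l2_opNorm_mul _ _).trans (mul_le_mul t0 hP (norm_nonneg _) (mul_nonneg hgu0 hα))
  have t3 : ‖Su⁻¹ * (Yu - Y₁) * (S₁⁻¹ * Dtᴴ)‖ ≤ gu * y * Real.sqrt g₁ :=
    (Matrix.l2_opNorm_mul _ _).trans (mul_le_mul ((Matrix.l2_opNorm_mul _ _).trans (mul_le_mul hgu hy (norm_nonneg _) hgu0)) hB
      (norm_nonneg _) (mul_nonneg hgu0 ((norm_nonneg _).trans hy)))
  calc _ ≤ ‖Su⁻¹ * Wᴴ‖ + ‖Su⁻¹ * (Dt + W)ᴴ * W * (S₁⁻¹ * Dtᴴ) + Su⁻¹ * Wᴴ * (Dt * S₁⁻¹ * Dtᴴ)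
          + Su⁻¹ * (Yu - Y₁) * (S₁⁻¹ * Dtᴴ)‖ := norm_sub_le _ _
    _ ≤ ‖Su⁻¹ * Wᴴ‖ + ((‖Su⁻¹ * (Dt + W)ᴴ * W * (S₁⁻¹ * Dtᴴ)‖ + ‖Su⁻¹ * Wᴴ * (Dt * S₁⁻¹ * Dtᴴ)‖)
          + ‖Su⁻¹ * (Yu - Y₁) * (S₁⁻¹ * Dtᴴ)‖) :=
        add_le_add le_rfl ((norm_add_le _ _).trans (add_le_add (norm_add_le _ _) le_rfl))
    _ ≤ gu * α + ((Real.sqrt gu * α * Real.sqrt g₁ + gu * α * 1) + gu * y * Real.sqrt g₁) :=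
        add_le_add t0 (add_le_add (add_le_add t1 t2) t3)
    _ = _ := by ring

end Resolvents

end Summit.QuantumFields.BalabanUV.T4Continuum.GaugeTermResolventBounds

end
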